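import Summits.QuantumFields.QCD.Theses.QuarksAsStableAction
import Summits.QuantumFields.QCD.Theses.WilsonQuarkChessboard
import Summits.QuantumFields.QCD.Theorems.QuarksAsStableActionCriticalLineDiamagnetismStubBackgroundSchwarz
import Summits.QuantumFields.QCD.Theorems.QuarksAsStableActionWilsonQuarkStabilityParityGlue

/-!
# Wilson-quark stability on EVEN tori — unconditional (line `Sketch`, crux `QuarksAsStableAction.WilsonQuarkStability`,
item stmt-QuantumFields-9736; stub `stub_backgroundSchwarz` + the even half of the crux, `--supports`)

Item stmt-QuantumFields-10349 (`WilsonQuarkChessboard.BackgroundSchwarz`, the background Schwarz inequality of the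
all-axes antiperiodic `r = 1` Wilson determinant across the time site-planes `0 | L/2`) was CLOSED `proved` on
2026-08-16 by `Cruxes.CriticalLineDiamagnetism.ChessboardCellGain.stub_backgroundSchwarz` (file
`QuarksAsStableActionCriticalLineDiamagnetismStubBackgroundSchwarz.lean`, assembling the twelve
`WilsonQuarkChessboardBackgroundSchwarz*.lean` files of prover-pitem-stmt-QuantumFields-10349-0).  Hence:

* `stub_backgroundSchwarz` — the registered stub of line `Sketch` (this namespace), by that theorem;
* `wilsonQuarkStability_even` — **the crux `QuarksAsStableAction.WilsonQuarkStability` VERBATIM with `Even L →`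
  inserted, now a theorem with no hypotheses**: `wilsonQuarkStabilityEven_of_backgroundSchwarz` (p114957: FILS
  iteration p112660 ⇒ quark chessboard ⇒ stubs 1–6 of the line, p111179) applied to it.  Axioms: propext,
  Classical.choice, Quot.sound.

What separates this from the crux as typed is only the quantifier over ODD torus sides (registered stub
`stub_oddVolumes`; parity glue `wilsonQuarkStability_of_even_of_odd` landed in p114957).  Pure theorem file.
-/

namespace Summit.QuantumFields.QCD.Cruxes.WilsonQuarkStability.FreeTangentLandauChessboard

/-- Stub `stub_backgroundSchwarz` of line `Sketch`: the route declaration `WilsonQuarkChessboard.BackgroundSchwarz`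
(item stmt-QuantumFields-10349), by the sibling line's closing theorem
`ChessboardCellGain.stub_backgroundSchwarz`. -/
theorem stub_backgroundSchwarz : Summit.QuantumFields.QCD.Theses.WilsonQuarkChessboard.BackgroundSchwarz :=
  Summit.QuantumFields.QCD.Cruxes.CriticalLineDiamagnetism.ChessboardCellGain.stub_backgroundSchwarz

/-- **Wilson-quark stability on even tori (unconditional).**  There are `ε, δ > 0`, constants `K, c₂, C` and `L₀`
such that for every EVEN `L ≥ L₀`, every bare mass `|m| ≤ ε` and every `SU(3)` lattice gauge field `U` on `(ℤ/L)⁴`,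
the `r = 1` Wilson determinant with quarks antiperiodic in all four directions obeys
`‖det D_AP[U,m]‖ ≤ exp(K + c₂·S_good(U) + C·N_bad(U)) · ‖det D_AP[1,m]‖` — the statement of the crux
`QuarksAsStableAction.WilsonQuarkStability` verbatim with `Even L →` inserted after `L₀ ≤ L →` (written let-free).
Proof: background Schwarz (item 10349) ⇒ FILS chessboard ⇒ free-tangent bound + cell gauge ⇒ tiling stability ⇒
transfer (line `Sketch`, all landed); in fact with `K = 0`, `δ = 1`. -/
theorem wilsonQuarkStability_even :
    ∃ ε δ K c₂ C : ℝ, 0 < ε ∧ 0 < δ ∧ ∃ L₀ : ℕ, ∀ (L : ℕ) [NeZero L], L₀ ≤ L → Even L →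
        ∀ m : ℝ, |m| ≤ ε → ∀ U : Literature.MathematicalPhysics.QuantumFieldTheory.GaugeConfig 4 L (Matrix.specialUnitaryGroup (Fin 3) ℂ),
          ‖Literature.MathematicalPhysics.QuantumLattice.fermionDet (Literature.MathematicalPhysics.QuantumLattice.wilsonDirac (Literature.MathematicalPhysics.QuantumLattice.unitaryFundamentalRep (Fin 3) ℂ) (fun e => if e.1 e.2 = -1 then -(⟨(U e).1, Matrix.specialUnitaryGroup_le_unitaryGroup (U e).2⟩ : Matrix.unitaryGroup (Fin 3) ℂ) else ⟨(U e).1, Matrix.specialUnitaryGroup_le_unitaryGroup (U e).2⟩) m 1)‖ ≤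
            Real.exp (K + c₂ * (∑ p ∈ Finset.univ.filter (fun p : Literature.MathematicalPhysics.QuantumFieldTheory.Plaquette 4 L => (3 - (Literature.MathematicalPhysics.QuantumLattice.fundamentalRep (Fin 3) (Literature.MathematicalPhysics.QuantumFieldTheory.plaquetteHolonomy U p.1 p.2.1.1 p.2.1.2)).trace.re) < δ), (3 - (Literature.MathematicalPhysics.QuantumLattice.fundamentalRep (Fin 3) (Literature.MathematicalPhysics.QuantumFieldTheory.plaquetteHolonomy U p.1 p.2.1.1 p.2.1.2)).trace.re)) +
              C * ((Finset.univ.filter (fun p : Literature.MathematicalPhysics.QuantumFieldTheory.Plaquette 4 L => δ ≤ (3 - (Literature.MathematicalPhysics.QuantumLattice.fundamentalRep (Fin 3) (Literature.MathematicalPhysics.QuantumFieldTheory.plaquetteHolonomy U p.1 p.2.1.1 p.2.1.2)).trace.re))).card : ℝ)) *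
            ‖Literature.MathematicalPhysics.QuantumLattice.fermionDet (Literature.MathematicalPhysics.QuantumLattice.wilsonDirac (Literature.MathematicalPhysics.QuantumLattice.unitaryFundamentalRep (Fin 3) ℂ) (fun e => if e.1 e.2 = -1 then -(⟨((1 : Literature.MathematicalPhysics.QuantumFieldTheory.GaugeConfig 4 L (Matrix.specialUnitaryGroup (Fin 3) ℂ)) e).1, Matrix.specialUnitaryGroup_le_unitaryGroup ((1 : Literature.MathematicalPhysics.QuantumFieldTheory.GaugeConfig 4 L (Matrix.specialUnitaryGroup (Fin 3) ℂ)) e).2⟩ : Matrix.unitaryGroup (Fin 3) ℂ) else ⟨((1 : Literature.MathematicalPhysics.QuantumFieldTheory.GaugeConfig 4 L (Matrix.specialUnitaryGroup (Fin 3) ℂ)) e).1, Matrix.specialUnitaryGroup_le_unitaryGroup ((1 : Literature.MathematicalPhysics.QuantumFieldTheory.GaugeConfig 4 L (Matrix.specialUnitaryGroup (Fin 3) ℂ)) e).2⟩) m 1)‖ :=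
  wilsonQuarkStabilityEven_of_backgroundSchwarz stub_backgroundSchwarz

end Summit.QuantumFields.QCD.Cruxes.WilsonQuarkStability.FreeTangentLandauChessboard
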